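import Summits.ABC.IUTFork.Thm311RealInd1StripPacketFloorBit
import Summits.ABC.IUTFork.Thm311RealInd1StripPacketThetaJunctionResidue
import HarnessLib

/-!
# [IUTchIII] Thm 3.11 (i) (Ind1)+(Ind2) ⟶ Cor 3.12 Step (x), reading (P): the packet–Θ junction with the residue-degree hypothesis REPLACED by
# the depth-`e` BIT — at a factor of residue degree one the junction identity needs exactly «some realised strip automorphism moves the base line
# modulo `𝔪^{e+1}`» (modulo `JannsenWingbergMappingClass`)

PROOF-ONLY file (abc-iut cell, Cor. 3.12 sub-crew, seat abc-iut-c312-1 = holder of record of the typed [IUTchIII] Thm. 3.11, gen 18; row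
«R24 = C:F1-DEPTH-E-DICHOTOMY», KEY F1DICHOTOMY, C LEAD ruling C-R152 (f); file 4 of the row — the junction corollary).  TAKES NO SIDE on [IUTchIII]
Cor. 3.12.  No definition, no `Prop` fact; `JannsenWingbergMappingClass` is the only conditional input (binder `hMC`); the depth-`e` bit enters as ONE
displayed binder per factor of residue degree one (`hbit`).  The R21/R22 theorems (p538494 / p541705) stay as landed; the new theorems carry the bit IN
PLACE OF their residue hypotheses `hf` / `hres` / `hram`+`hlast` and imply them wherever those hold trivially (a factor with `f ≠ 1` needs no bit).

* §1 packet level **`packetHull_iUnion_image_iota_smul_normalizedPacket_eq_of_bit_of_jannsenWingbergMappingClass`** — R22's print-side core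
  (`…_of_residue_…`, p541705) with `hres : ∀ i, f(w_i|p) = 1 → (i = i₀ ∧ e_{i₀} ∤ v)` replaced by
  `hbit : ∀ i, f(w_i|p) = 1 → (i = i₀ → e_{i₀} ∣ v) → (some ψ ∈ Real.ind1StripOf w_i (galoisLog w_i) moves ℤ_p·p mod p·log_p(𝒪_{w_i}^×))`:
  exactly the factors whose box ball is the depth-`e` ball at residue degree one (every `i ≠ i₀` with `f = 1`; `i₀` iff `f = 1 ∧ e_{i₀} ∣ v`) carry
  the bit; the packet floor is file 3's `packetHull_eq_of_balls_bit_of_jannsenWingbergMappingClass`; everything else verbatim (box `ι_{i₀}(g)·R_I`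
  of total content `p^{A}`, container side by the star form).
* §2 place-section level **`localFields_packetHull_orbitH_pilotRegion_eq_slotImagesHull_of_bit_of_jannsenWingbergMappingClass`** — the
  `(R_I)^∼`-hull of the `H`-orbit of `O_𝕃(−P_Θ)_{v⃗}` equals `slotImagesHull`, the bit displayed at the factors `b` with `f(v̲_b|p) = 1` (at
  `b = j` only when `e(v̲_j|p) ∣ ord t_{i,v_j}`); §3 **`localFields_lnνLp_hull_orbitH_eq_negLogThetaPerImageAt_of_bit_of_jannsenWingbergMappingClass`**
  — `ln ν̄_{𝕃_p}` of the `H`-reading `= −|log(Θ)|^{(P)}_p` under the per-collection bit family; `bit_of_residue`: R22's `hres` implies the bit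
  family VACUOUSLY (no factor then needs a bit), so the new theorems imply p541705's.
READING (numbers about OUR typed objects; neutral): combined with files 1–2 of the row (p550084 / p550723), the tame odd-degree junction programme
of gens 15–17 now rests, at each place of residue degree one, on ONE displayed bit of the realised strip group with both single-place branches
computed (bit ⇒ container hull; no bit ⇒ the depth-`e` factor ball is strip-INVARIANT); nothing here decides any bit; the packet-level value of
the hull when a bit FAILS is NOT computed here (the Θ-region `ι(t)·(R_I)^∼` exceeds the box).  HONEST SCOPE as in R21/R22: OUR typings (THE
equivariant lift, THE logarithm, factorwise action; F-B28-1 untouched); conditional on `hMC`; EVEN local degree (NOT typed), WILD, `p = 2` remain;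
equal-AS-TYPED ≠ equal in print; nothing here asserts that abc is proved or refuted; no side taken on [IUTchIII] Cor. 3.12 / [IUTchIV] Thm. 1.10
or on any author. [claim: Mochizuki2012, status: disputed]; [cite: Mochizuki2012, IUTchIII Thm. 3.11 (i) p. 154; Rmk. 3.9.5 (i) p. 127; Cor. 3.12
Step (x)/(xi) pp. 181–183; IUTchIV Prop. 1.2 (ii) pp. 10–11]; [cite: Kondo2025OuterAutMLF, §3 Thm 3.17, Rem 3.18; p. 5];
[cite: DupuyHilado2025, §4.9, §4.12]. typed ≠ proved; a conditional theorem discharges nothing it binds.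
-/

set_option autoImplicit false

noncomputable section

open Metric Set Function
open scoped Pointwise TensorProduct

namespace Summit.ABC.IUTFork.Thm311.Real

open NumberField IsDedekindDomain Literature.NumberTheory.NumberFields Literature.IUT.LogVolume
open Literature.NumberTheory.GaloisRepresentations Literature.NumberTheory.GaloisRepresentations.Ultrametric
open Literature.AnabelianGeometry.AbsoluteAnabelian Literature.IUT.HodgeArakelov
open Literature.IUT.HodgeArakelov.AbsTopMonoids

/-! ## §1 Packet level: the junction under the depth-`e` bit -/

section GenuineFactors

variable {K : Type} [Field K] [NumberField K] (p : ℕ) [hp : Fact p.Prime]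
variable {I : Type} [Fintype I] [DecidableEq I] (w : I → HeightOneSpectrum (𝓞 K)) (hw : ∀ i, ((p : ℕ) : 𝓞 K) ∈ (w i).asIdeal)

/-- **PRINT SIDE — THE JUNCTION at the packet, the residue hypothesis replaced by the DEPTH-`e` BIT (modulo `JannsenWingbergMappingClass`).**
Same packet as R22's `packetHull_iUnion_image_iota_smul_normalizedPacket_eq_of_residue_of_jannsenWingbergMappingClass` (p541705): every factor
TAME of ODD local degree `≥ 3`, `‖g‖ = p^{−v/e_{i₀}}`; but a factor of residue degree `f(w_i|p) = 1` is now ALLOWED wherever its box ball is the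
depth-`e` ball — every `i ≠ i₀`, and `i₀` when `e_{i₀} ∣ v` — PROVIDED some realised strip automorphism at `w_i` moves the base line `ℤ_p·p` modulo
`p·log_p(𝒪_{w_i}^×) = 𝔪^{e_i+1}` (hypothesis `hbit`, one displayed binder per such factor; file 2 of the row computes both single-place branches).
For every subgroup `H ≤ indTwo` containing the single-factor strip moves: the `(R_I)^∼`-hull of the `H`-orbit of the twist `ι_{i₀}(g)·(R_I)^∼`
IS `packetHull(p^{A}·log_p(R_I^×))`, `A = (v − 1) div e_{i₀} + 1 − |I|` (container side: the star form; print side: file 3's packet floor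
`packetHull_eq_of_balls_bit_of_jannsenWingbergMappingClass` on the box `ι_{i₀}(g)·R_I`). [claim: Mochizuki2012, status: disputed]
[cite: Mochizuki2012, IUTchIII Thm. 3.11 (i) p. 154; Rmk. 3.9.5 (i) p. 127; Cor. 3.12 Step (xi) p. 183; IUTchIV Prop. 1.2 (ii) p. 10–11]
[cite: Kondo2025OuterAutMLF, §3 Thm 3.17, Rem 3.18] [cite: DupuyHilado2025, §4.9, §4.12] -/
theorem packetHull_iUnion_image_iota_smul_normalizedPacket_eq_of_bit_of_jannsenWingbergMappingClass [Nonempty I]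
    (hMC : JannsenWingbergMappingClass) (hp2 : 2 < p)
    (he : ∀ i, absRamificationIdx p (RescaledCompletion K p (w i) (hw i)) ≤ p - 2)
    (h3 : ∀ i, 3 ≤ localDeg K (w i)) (hodd : ∀ i, Odd (localDeg K (w i)))
    (i₀ : I) {g : RescaledCompletion K p (w i₀) (hw i₀)} {v : ℤ}
    (hv : ‖g‖ = (p : ℝ) ^ (-(v / (absRamificationIdx p (RescaledCompletion K p (w i₀) (hw i₀)) : ℝ))))
    (hbit : ∀ i, (w i).asIdeal.inertiaDeg ℤ = 1 →
      (i = i₀ → ((absRamificationIdx p (RescaledCompletion K p (w i₀) (hw i₀)) : ℤ) ∣ v)) →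
      ∃ ψ ∈ ind1StripOf (w i) (galoisLog (w i)),
        RescaledCompletion.of K p (w i) (hw i) (ψ (p : (w i).adicCompletion K)) - (p : RescaledCompletion K p (w i) (hw i)) ∉
          (p : ℚ_[p]) • logUnits (RescaledCompletion K p (w i) (hw i)))
    (H : Subgroup (PacketAlgebra p (fun i => RescaledCompletion K p (w i) (hw i)) ≃ₗ[ℚ_[p]]
      PacketAlgebra p (fun i => RescaledCompletion K p (w i) (hw i))))
    (hH : H ≤ indTwo p (fun i => RescaledCompletion K p (w i) (hw i)))
    (hstrip : ∀ (i₁ : I), ∀ ψ ∈ ind1StripOf (w i₁) (galoisLog (w i₁)), ∃ γ ∈ H,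
      ∀ z : Π i, RescaledCompletion K p (w i) (hw i),
        (γ : PacketAlgebra p (fun i => RescaledCompletion K p (w i) (hw i)) ≃ₗ[ℚ_[p]]
            PacketAlgebra p (fun i => RescaledCompletion K p (w i) (hw i))) (PiTensorProduct.tprod ℚ_[p] z) =
          PiTensorProduct.tprod ℚ_[p] (update z i₁ (RescaledCompletion.of K p (w i₁) (hw i₁)
            (ψ ((RescaledCompletion.of K p (w i₁) (hw i₁)).symm (z i₁)))))) :
    packetHull p (fun i => RescaledCompletion K p (w i) (hw i))
        (⋃ γ : H, (γ : PacketAlgebra p (fun i => RescaledCompletion K p (w i) (hw i)) ≃ₗ[ℚ_[p]]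
            PacketAlgebra p (fun i => RescaledCompletion K p (w i) (hw i))) ''
          (iota p (fun i => RescaledCompletion K p (w i) (hw i)) i₀ g •
            (normalizedPacket p (fun i => RescaledCompletion K p (w i) (hw i)) :
              Set (PacketAlgebra p (fun i => RescaledCompletion K p (w i) (hw i)))))) =
      packetHull p (fun i => RescaledCompletion K p (w i) (hw i))
        (((p : ℚ_[p]) ^ ((v - 1) / (absRamificationIdx p (RescaledCompletion K p (w i₀) (hw i₀)) : ℤ) + 1 - Fintype.card I)) •
          (logPacket p (fun i => RescaledCompletion K p (w i) (hw i)) :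
            Set (PacketAlgebra p (fun i => RescaledCompletion K p (w i) (hw i))))) := by
  classical
  set k := fun i => RescaledCompletion K p (w i) (hw i) with hk
  set e := fun i => RescaledCompletion.of K p (w i) (hw i) with he_def
  set E : ℕ := absRamificationIdx p (k i₀) with hE
  set A : ℤ := (v - 1) / (E : ℤ) + 1 - Fintype.card I with hA
  set L : Set (PacketAlgebra p k) := (logPacket p k : Set (PacketAlgebra p k)) with hL
  set M : Set (PacketAlgebra p k) := iota p k i₀ g • (normalizedPacket p k : Set (PacketAlgebra p k)) with hM
  set O : Set (PacketAlgebra p k) := ⋃ γ : H, (γ : PacketAlgebra p k ≃ₗ[ℚ_[p]] PacketAlgebra p k) '' M with hO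
  set N : AddSubgroup (PacketAlgebra p k) := AddSubgroup.closure O with hN
  have hP : p.Prime := Fact.out
  have hp0 : (0 : ℝ) < p := by exact_mod_cast hP.pos
  have hpQ : (p : ℚ_[p]) ≠ 0 := by exact_mod_cast hP.ne_zero
  have hE0 : 0 < E := absRamificationIdx_pos p (k i₀)
  have hE0z : (0 : ℤ) < (E : ℤ) := by exact_mod_cast hE0
  have hg0 : g ≠ 0 := norm_pos_iff.mp (by rw [hv]; positivity)
  -- container side: `M ⊆ p^A·L`, hence `O ⊆ p^A·L` and `N ⊆ p^A·L ⊆ packetHull(p^A·L)`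
  obtain ⟨hMA, hOA'⟩ := packetHull_iUnion_image_iota_smul_normalizedPacket_subset_of_tame p w hw hp2 he i₀ hv H hH
  have hOA : O ⊆ ((p : ℚ_[p]) ^ A) • L := by
    refine Set.iUnion_subset fun γ => ?_
    calc (γ : PacketAlgebra p k ≃ₗ[ℚ_[p]] PacketAlgebra p k) '' M
        ⊆ (γ : PacketAlgebra p k ≃ₗ[ℚ_[p]] PacketAlgebra p k) '' (((p : ℚ_[p]) ^ A) • L) := Set.image_mono hMA
      _ = ((p : ℚ_[p]) ^ A) • L := image_const_smul_logPacket_of_mem_indTwo p k (hH γ.2) _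
  have hNA : (N : Set (PacketAlgebra p k)) ⊆ ((p : ℚ_[p]) ^ A) • L := by
    have h : N ≤ ((p : ℚ_[p]) ^ A) • logPacket p k :=
      (AddSubgroup.closure_le _).mpr (by rw [AddSubgroup.coe_pointwise_smul]; exact hOA)
    intro x hx
    have hx' : x ∈ ((p : ℚ_[p]) ^ A) • logPacket p k := h hx
    rwa [← SetLike.mem_coe, AddSubgroup.coe_pointwise_smul] at hx'
  -- the box data: depth `n = (v−1) mod e + 1` and content `p^{(v−1) div e}` at `i₀`, `p⁻¹·𝔪^{e_i}` elsewhere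
  set a : ℤ := (v - 1) / (E : ℤ) with ha
  set r : ℤ := (v - 1) % (E : ℤ) with hr
  have hr0 : 0 ≤ r := Int.emod_nonneg _ hE0z.ne'
  have hrE : r < E := Int.emod_lt_of_pos _ hE0z
  have hvar : v - 1 = (E : ℤ) * a + r := by rw [hr, Int.emod_def]; ring
  set n : ℕ := r.toNat + 1 with hn
  have hnr : (n : ℤ) = r + 1 := by rw [hn, Nat.cast_add, Nat.cast_one, Int.toNat_of_nonneg hr0]
  have hn1 : 1 ≤ n := Nat.le_add_left 1 _
  have hnE : n ≤ E := by omega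
  have hvR : (v : ℝ) = (E : ℝ) * a + n := by
    have h1 : v = (E : ℤ) * a + n := by rw [hnr]; omega
    exact_mod_cast h1
  let cc : I → ℚ_[p] := fun i => if i = i₀ then (p : ℚ_[p]) ^ a else (p : ℚ_[p])⁻¹
  let nn : I → ℕ := fun i => if i = i₀ then n else absRamificationIdx p (k i)
  have hcc0 : ∀ i, cc i ≠ 0 := by
    intro i; by_cases hi : i = i₀
    · simp only [cc, if_pos hi]; exact zpow_ne_zero _ hpQ
    · simp only [cc, if_neg hi]; exact inv_ne_zero hpQ
  have hnn1 : ∀ i, 1 ≤ nn i := by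
    intro i; by_cases hi : i = i₀
    · simp only [nn, if_pos hi]; exact hn1
    · simp only [nn, if_neg hi]; exact absRamificationIdx_pos p (k i)
  have hnne : ∀ i, nn i ≤ absRamificationIdx p (k i) := by
    intro i; by_cases hi : i = i₀
    · subst hi; simp only [nn, if_pos rfl]; exact hnE
    · simp only [nn, if_neg hi]; exact le_rfl
  have hbit' : ∀ i, nn i = absRamificationIdx p (k i) → (w i).asIdeal.inertiaDeg ℤ = 1 →
      ∃ ψ ∈ ind1StripOf (w i) (galoisLog (w i)),
        e i (ψ (p : (w i).adicCompletion K)) - (p : k i) ∉ (p : ℚ_[p]) • logUnits (k i) := by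
    intro i hni hfi
    refine hbit i hfi fun hi => ?_
    subst hi
    simp only [nn, if_pos rfl] at hni
    refine ⟨a + 1, ?_⟩
    have hnE' : (n : ℤ) = E := by exact_mod_cast hni
    have : v = (E : ℤ) * a + r + 1 := by rw [hr, ha, Int.emod_def]; ring
    rw [hnr] at hnE'
    linarith
  -- radii of the box: `‖g‖` at `i₀`, `1` elsewhere
  have hrad₀ : ‖cc i₀‖ * (p : ℝ) ^ (-((nn i₀ : ℝ) / (absRamificationIdx p (k i₀) : ℝ))) = ‖g‖ := by
    simp only [cc, nn, if_pos rfl]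
    rw [hv, norm_zpow, Padic.norm_p, inv_zpow', ← Real.rpow_intCast, ← Real.rpow_add hp0]
    congr 1
    have hE0r : (E : ℝ) ≠ 0 := by exact_mod_cast hE0.ne'
    rw [show (absRamificationIdx p (RescaledCompletion K p (w i₀) (hw i₀)) : ℝ) = E from rfl, hvR]
    push_cast
    field_simp
    ring
  have hrad : ∀ i, i ≠ i₀ → ‖cc i‖ * (p : ℝ) ^ (-((nn i : ℝ) / (absRamificationIdx p (k i) : ℝ))) = 1 := by
    intro i hi
    simp only [cc, nn, if_neg hi]
    have hEi : (absRamificationIdx p (k i) : ℝ) ≠ 0 := by exact_mod_cast (absRamificationIdx_pos p (k i)).ne'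
    rw [norm_inv, Padic.norm_p, inv_inv, div_self hEi, Real.rpow_neg_one, mul_inv_cancel₀ hp0.ne']
  -- the pure tensors of the box lie in `M ⊆ O ⊆ N`
  have hMO : M ⊆ O := by
    intro x hx
    refine Set.mem_iUnion.mpr ⟨(1 : H), ?_⟩
    rw [OneMemClass.coe_one, LinearEquiv.coe_one, Set.image_id]
    exact hx
  have hbox : ∀ x : Π i, (w i).adicCompletion K,
      (∀ i, ‖e i (x i)‖ ≤ ‖cc i‖ * (p : ℝ) ^ (-((nn i : ℝ) / (absRamificationIdx p (k i) : ℝ)))) →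
      PiTensorProduct.tprod ℚ_[p] (fun i => e i (x i)) ∈ N := by
    intro x hx
    refine AddSubgroup.subset_closure (hMO ?_)
    -- `⊗ x = ι_{i₀}(g)·⊗ y`, `y = x[i₀ ↦ g⁻¹ x_{i₀}]`, `y` integral in every factor
    let y : Π i, k i := update (fun i => e i (x i)) i₀ (g⁻¹ * e i₀ (x i₀))
    have hy1 : ∀ i, ‖y i‖ ≤ 1 := by
      intro i; by_cases hi : i = i₀
      · subst hi
        simp only [y, update_self]
        rw [norm_mul, norm_inv, inv_mul_le_iff₀ (norm_pos_iff.mpr hg0), mul_one, ← hrad₀]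
        exact hx _
      · simp only [y, update_of_ne hi]
        rw [← hrad i hi]; exact hx i
    refine ⟨purePacket p k y, integerPacket_le_normalizedPacket p k (purePacket_mem_integerPacket p k hy1), ?_⟩
    show iota p k i₀ g * purePacket p k y = PiTensorProduct.tprod ℚ_[p] (fun i => e i (x i))
    rw [iota_mul_purePacket]
    simp only [y, update_self, update_idem, mul_inv_cancel_left₀ hg0, update_eq_self]
    rfl
  -- `N` is stable under the single-factor strip moves (realised in `H`; the span of the `H`-orbit is `H`-stable)
  have hNstrip : ∀ (i₁ : I), ∀ ψ ∈ ind1StripOf (w i₁) (galoisLog (w i₁)), ∀ z : Π i, k i,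
      PiTensorProduct.tprod ℚ_[p] z ∈ N →
        PiTensorProduct.tprod ℚ_[p] (update z i₁ (e i₁ (ψ ((e i₁).symm (z i₁))))) ∈ N := by
    intro i₁ ψ hψ z hz
    obtain ⟨γ₀, hγ₀H, hγ₀⟩ := hstrip i₁ ψ hψ
    have h := map_closure_iUnion_image_le p k M H hγ₀H ⟨_, hz, rfl⟩
    change γ₀ (PiTensorProduct.tprod ℚ_[p] z) ∈ N at h
    rwa [hγ₀ z] at h
  -- the total content of the box is `p^A`
  have hprod : ∏ i, cc i = (p : ℚ_[p]) ^ A := by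
    rw [← Finset.mul_prod_erase Finset.univ cc (Finset.mem_univ i₀)]
    have h1 : ∏ i ∈ Finset.univ.erase i₀, cc i = ((p : ℚ_[p])⁻¹) ^ (Fintype.card I - 1) := by
      rw [Finset.prod_congr rfl (fun i hi => show cc i = (p : ℚ_[p])⁻¹ by
        simp only [cc, if_neg (Finset.ne_of_mem_erase hi)]), Finset.prod_const,
        Finset.card_erase_of_mem (Finset.mem_univ _), Finset.card_univ]
    rw [h1]
    simp only [cc, if_pos rfl]
    rw [inv_pow, ← zpow_natCast, ← zpow_neg, ← zpow_add₀ hpQ]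
    congr 1
    have hI : 1 ≤ Fintype.card I := Fintype.card_pos
    rw [hA, ha, Nat.cast_sub hI]
    push_cast
    ring
  -- the packet floor on `N`
  have hNc : (N : Set (PacketAlgebra p k)) ⊆ packetHull p k ((∏ i, cc i) • L) := by
    rw [hprod]; exact hNA.trans (subset_packetHull p k _)
  have hfloor := packetHull_eq_of_balls_bit_of_jannsenWingbergMappingClass p w hw hMC hp2 he h3 hodd cc hcc0 nn hnn1 hnne
    hbit' N hbox hNstrip hNc
  rw [hprod] at hfloor
  rw [← packetHull_coe_closure_eq p k O]
  exact hfloor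

omit [Fintype I] [DecidableEq I] in
/-- R22's exact residue hypothesis `hres` («`f = 1` only at `i₀`, and then `e_{i₀} ∤ v`») implies the bit family VACUOUSLY (no factor then carries a
depth-`e` ball at residue degree one); so the `_of_bit_` theorem implies p541705's `_of_residue_` theorem (and, via `residue_of_inertiaDeg_ne_one`,
R21's p538494). [cite: Mochizuki2012, IUTchIII Thm. 3.11 (i) p. 154] -/
theorem bit_of_residue (i₀ : I) (v : ℤ)
    (hres : ∀ i, (w i).asIdeal.inertiaDeg ℤ = 1 →
      i = i₀ ∧ ¬ ((absRamificationIdx p (RescaledCompletion K p (w i₀) (hw i₀)) : ℤ) ∣ v)) :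
    ∀ i, (w i).asIdeal.inertiaDeg ℤ = 1 →
      (i = i₀ → ((absRamificationIdx p (RescaledCompletion K p (w i₀) (hw i₀)) : ℤ) ∣ v)) →
      ∃ ψ ∈ ind1StripOf (w i) (galoisLog (w i)),
        RescaledCompletion.of K p (w i) (hw i) (ψ (p : (w i).adicCompletion K)) - (p : RescaledCompletion K p (w i) (hw i)) ∉
          (p : ℚ_[p]) • logUnits (RescaledCompletion K p (w i) (hw i)) := by
  intro i hfi hdvd
  obtain ⟨rfl, hndvd⟩ := hres i hfi
  exact absurd (hdvd rfl) hndvd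

end GenuineFactors

/-! ## §2 Place-section level: the junction under the depth-`e` bit -/

section PlaceSection

variable {F₀ : Type} [Field F₀] [NumberField F₀] {K : Type} [Field K] [NumberField K] [Algebra F₀ K]
variable (σ : PlaceSection F₀ K) (p : ℕ) [hp : Fact p.Prime]
variable (c : (j : ℕ) → (Fin (j + 1) → placesOver F₀ p) → ℚ_[p]) (hc0 : ∀ j e, c j e ≠ 0)
  (hcσ : ∀ (j : ℕ) (τ : Equiv.Perm (Fin (j + 1))) (e : Fin (j + 1) → placesOver F₀ p), c j (e ∘ τ) = c j e)

/-- **THE PACKET–THETA JUNCTION under the DEPTH-`e` BIT (modulo `JannsenWingbergMappingClass`).**  Setting of R21/R22 at one collection `v⃗` of a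
genuine place-section packet (every factor tame of odd local degree `≥ 3`, `‖t_{i,v_j}‖ = p^{−v/e(v̲_j|p)}`, `H ≤ indTwo` containing the single-factor
(Ind1) strip moves); the residue hypotheses `hram`/`hlast` of p541705 REPLACED by the bit: at every factor `b` of residue degree one — at `b = j`
only when `e(v̲_j|p) ∣ v` — some realised strip automorphism at `v̲_b` moves `ℤ_p·p` modulo `p·log_p(𝒪_{v̲_b}^×)`.  Conclusion unchanged: the
`(R_I)^∼`-hull of the `H`-orbit of `O_𝕃(−P_Θ)_{v⃗}` equals `slotImagesHull`. [claim: Mochizuki2012, status: disputed]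
[cite: Mochizuki2012, IUTchIII Thm. 3.11 (i) p. 154; Cor. 3.12 Step (x)/(xi) pp. 181–183] [cite: Kondo2025OuterAutMLF, §3 Thm 3.17, Rem 3.18]
[cite: DupuyHilado2025, §4.9, §4.12] -/
theorem localFields_packetHull_orbitH_pilotRegion_eq_slotImagesHull_of_bit_of_jannsenWingbergMappingClass
    (hMC : JannsenWingbergMappingClass) (hp2 : 2 < p) {lstar : ℕ}
    (t : Fin lstar → (v : placesOver F₀ p) → ((σ.localFields p).k v)ˣ) (i : Fin lstar)
    (e : Fin ((i : ℕ) + 1 + 1) → placesOver F₀ p)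
    (he : ∀ b, absRamificationIdx p ((σ.localFields p).k (e b)) ≤ p - 2)
    (h3 : ∀ b, 3 ≤ localDeg K (σ.lift (e b).1)) (hodd : ∀ b, Odd (localDeg K (σ.lift (e b).1)))
    {v : ℤ} (hv : ‖(t i (e (Fin.last _)) : (σ.localFields p).k (e (Fin.last _)))‖ =
      (p : ℝ) ^ (-(v / (absRamificationIdx p ((σ.localFields p).k (e (Fin.last _))) : ℝ))))
    (hbit : ∀ b, (σ.lift (e b).1).asIdeal.inertiaDeg ℤ = 1 →
      (b = Fin.last _ → ((absRamificationIdx p ((σ.localFields p).k (e (Fin.last _))) : ℤ) ∣ v)) →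
      ∃ ψ ∈ ind1StripOf (σ.lift (e b).1) (galoisLog (σ.lift (e b).1)),
        RescaledCompletion.of K p (σ.lift (e b).1) (σ.natCast_mem_lift (e b)) (ψ (p : (σ.lift (e b).1).adicCompletion K)) -
            (p : RescaledCompletion K p (σ.lift (e b).1) (σ.natCast_mem_lift (e b))) ∉
          (p : ℚ_[p]) • logUnits (RescaledCompletion K p (σ.lift (e b).1) (σ.natCast_mem_lift (e b))))
    (H : Subgroup (PacketAlgebra p (fun b => (σ.localFields p).k (e b)) ≃ₗ[ℚ_[p]]
      PacketAlgebra p (fun b => (σ.localFields p).k (e b))))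
    (hH : H ≤ indTwo p (fun b => (σ.localFields p).k (e b)))
    (hstrip : ∀ (b₀ : Fin ((i : ℕ) + 1 + 1)),
      ∀ ψ ∈ ind1StripOf (σ.lift (e b₀).1) (galoisLog (σ.lift (e b₀).1)), ∃ γ ∈ H,
        ∀ z : ∀ b, (σ.localFields p).k (e b),
          (γ : PacketAlgebra p (fun b => (σ.localFields p).k (e b)) ≃ₗ[ℚ_[p]]
              PacketAlgebra p (fun b => (σ.localFields p).k (e b))) (PiTensorProduct.tprod ℚ_[p] z) =
            PiTensorProduct.tprod ℚ_[p] (update z b₀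
              (RescaledCompletion.of K p (σ.lift (e b₀).1) (σ.natCast_mem_lift (e b₀))
                (ψ ((RescaledCompletion.of K p (σ.lift (e b₀).1) (σ.natCast_mem_lift (e b₀))).symm (z b₀)))))) :
    packetHull p (fun b => (σ.localFields p).k (e b))
        (⋃ γ : H, (γ : PacketAlgebra p (fun b => (σ.localFields p).k (e b)) ≃ₗ[ℚ_[p]]
            PacketAlgebra p (fun b => (σ.localFields p).k (e b))) ''
          (realPrimePacketWith p (σ.localFields p) c hc0 hcσ).pilotRegion t ((i : ℕ) + 1) e) =
      (realPrimePacketWith p (σ.localFields p) c hc0 hcσ).slotImagesHull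
        ((realPrimePacketWith p (σ.localFields p) c hc0 hcσ).pilotRegion t) ((i : ℕ) + 1) e := by
  have hcore := packetHull_iUnion_image_iota_smul_normalizedPacket_eq_of_bit_of_jannsenWingbergMappingClass p
    (fun b => σ.lift (e b).1) (fun b => σ.natCast_mem_lift (e b)) hMC hp2 he h3 hodd (Fin.last _) hv hbit H hH hstrip
  obtain ⟨-, hcont⟩ := packetHull_iUnion_image_iota_smul_normalizedPacket_subset_of_tame p
    (fun b => σ.lift (e b).1) (fun b => σ.natCast_mem_lift (e b)) hp2 he (Fin.last _) hv
    (indTwo p (fun b => (σ.localFields p).k (e b))) le_rfl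
  refine Set.Subset.antisymm ?_ ?_
  · exact packetHull_mono p _
      (realPrimePacketWith_orbitH_subset_slotImages p (σ.localFields p) c hc0 hcσ t i e H hH)
  · change packetHull p _ ((realPrimePacketWith p (σ.localFields p) c hc0 hcσ).slotImages _ _ e) ⊆ _
    rw [realPrimePacketWith_slotImages_pilotRegion_eq,
      Set.iUnion_congr (fun γ => indTwo_smul_set p (fun b => (σ.localFields p).k (e b)) γ _),
      realPrimePacketWith_pilotRegion_succ_eq]
    refine hcont.trans (le_of_eq ?_)
    exact hcore.symm

/-! ## §3 The `ln ν̄_{𝕃_p}`-level identity under the depth-`e` bit -/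

/-- **READING (P) OVER PRINT's (Ind1)⊔(Ind2) AS TYPED EQUALS `−|log(Θ)|^{(P)}_p`, under the DEPTH-`e` BIT (modulo `JannsenWingbergMappingClass`).**
Every `v̲ ∣ p` of the section tame of odd local degree `≥ 3`; a valuation family `v(i,v⃗)` of the Θ-idele at the last slots; at every factor `b` of a
collection with residue degree one — at the twisted factor only when `e ∣ v(i,v⃗)` — some realised strip automorphism at `v̲_b` moves `ℤ_p·p` modulo
`p·log_p(𝒪^×)` (the bit family `hbit`, displayed).  Then for any family `H` with `H ≤ indTwo` containing the single-factor strip moves: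
`ln ν̄_{𝕃_p}(v⃗ ↦ hull(⋃_{g ∈ H_{v⃗}} g(O_𝕃(−P_Θ)_{v⃗}))) = −|log(Θ)|^{(P)}_p`. [claim: Mochizuki2012, status: disputed]
[cite: Mochizuki2012, IUTchIII Thm. 3.11 (i) p. 154; Cor. 3.12 proof Step (x) p. 181] [cite: DupuyHilado2025, §4.9, §4.12] -/
theorem localFields_lnνLp_hull_orbitH_eq_negLogThetaPerImageAt_of_bit_of_jannsenWingbergMappingClass
    (hMC : JannsenWingbergMappingClass) (hp2 : 2 < p) {lstar : ℕ}
    (t : Fin lstar → (v : placesOver F₀ p) → ((σ.localFields p).k v)ˣ)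
    (he : ∀ v : placesOver F₀ p, absRamificationIdx p ((σ.localFields p).k v) ≤ p - 2)
    (h3 : ∀ v : placesOver F₀ p, 3 ≤ localDeg K (σ.lift v.1)) (hodd : ∀ v : placesOver F₀ p, Odd (localDeg K (σ.lift v.1)))
    (v : (i : Fin lstar) → (Fin ((i : ℕ) + 1 + 1) → placesOver F₀ p) → ℤ)
    (hv : ∀ (i : Fin lstar) (e : Fin ((i : ℕ) + 1 + 1) → placesOver F₀ p),
      ‖(t i (e (Fin.last _)) : (σ.localFields p).k (e (Fin.last _)))‖ =
        (p : ℝ) ^ (-(v i e / (absRamificationIdx p ((σ.localFields p).k (e (Fin.last _))) : ℝ))))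
    (hbit : ∀ (i : Fin lstar) (e : Fin ((i : ℕ) + 1 + 1) → placesOver F₀ p) (b : Fin ((i : ℕ) + 1 + 1)),
      (σ.lift (e b).1).asIdeal.inertiaDeg ℤ = 1 →
        (b = Fin.last _ → ((absRamificationIdx p ((σ.localFields p).k (e (Fin.last _))) : ℤ) ∣ v i e)) →
        ∃ ψ ∈ ind1StripOf (σ.lift (e b).1) (galoisLog (σ.lift (e b).1)),
          RescaledCompletion.of K p (σ.lift (e b).1) (σ.natCast_mem_lift (e b)) (ψ (p : (σ.lift (e b).1).adicCompletion K)) -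
              (p : RescaledCompletion K p (σ.lift (e b).1) (σ.natCast_mem_lift (e b))) ∉
            (p : ℚ_[p]) • logUnits (RescaledCompletion K p (σ.lift (e b).1) (σ.natCast_mem_lift (e b))))
    (H : (j : ℕ) → (e : Fin (j + 1) → placesOver F₀ p) →
      Subgroup (PacketAlgebra p (fun b => (σ.localFields p).k (e b)) ≃ₗ[ℚ_[p]]
        PacketAlgebra p (fun b => (σ.localFields p).k (e b))))
    (hH : ∀ j e, H j e ≤ indTwo p (fun b => (σ.localFields p).k (e b)))
    (hstrip : ∀ (i : Fin lstar) (e : Fin ((i : ℕ) + 1 + 1) → placesOver F₀ p) (b₀ : Fin ((i : ℕ) + 1 + 1)),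
      ∀ ψ ∈ ind1StripOf (σ.lift (e b₀).1) (galoisLog (σ.lift (e b₀).1)), ∃ γ ∈ H ((i : ℕ) + 1) e,
        ∀ z : ∀ b, (σ.localFields p).k (e b),
          (γ : PacketAlgebra p (fun b => (σ.localFields p).k (e b)) ≃ₗ[ℚ_[p]]
              PacketAlgebra p (fun b => (σ.localFields p).k (e b))) (PiTensorProduct.tprod ℚ_[p] z) =
            PiTensorProduct.tprod ℚ_[p] (update z b₀
              (RescaledCompletion.of K p (σ.lift (e b₀).1) (σ.natCast_mem_lift (e b₀))
                (ψ ((RescaledCompletion.of K p (σ.lift (e b₀).1) (σ.natCast_mem_lift (e b₀))).symm (z b₀)))))) :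
    (realPrimePacketWith p (σ.localFields p) c hc0 hcσ).lnνLp lstar (fun j e =>
        packetHull p (fun b => (σ.localFields p).k (e b))
          (⋃ g : H j e, (g : PacketAlgebra p (fun b => (σ.localFields p).k (e b)) ≃ₗ[ℚ_[p]]
              PacketAlgebra p (fun b => (σ.localFields p).k (e b))) ''
            (realPrimePacketWith p (σ.localFields p) c hc0 hcσ).pilotRegion t j e)) =
      (realPrimePacketWith p (σ.localFields p) c hc0 hcσ).negLogThetaPerImageAt lstar t := by
  refine realPrimePacketWith_lnνLp_hull_orbitH_eq_negLogThetaPerImageAt_of_forall_eq p (σ.localFields p) c hc0 hcσ t H fun i e => ?_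
  have hcore := packetHull_iUnion_image_iota_smul_normalizedPacket_eq_of_bit_of_jannsenWingbergMappingClass p
    (fun b => σ.lift (e b).1) (fun b => σ.natCast_mem_lift (e b)) hMC hp2 (fun b => he (e b)) (fun b => h3 (e b))
    (fun b => hodd (e b)) (Fin.last _) (hv i e) (hbit i e) (H _ e) (hH _ e) (hstrip i e)
  obtain ⟨-, hcont⟩ := packetHull_iUnion_image_iota_smul_normalizedPacket_subset_of_tame p
    (fun b => σ.lift (e b).1) (fun b => σ.natCast_mem_lift (e b)) hp2 (fun b => he (e b)) (Fin.last _) (hv i e)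
    (indTwo p (fun b => (σ.localFields p).k (e b))) le_rfl
  refine Set.Subset.antisymm ?_ ?_
  · exact packetHull_mono p _
      (realPrimePacketWith_orbitH_subset_slotImages p (σ.localFields p) c hc0 hcσ t i e (H _ e) (hH _ e))
  · rw [realPrimePacketWith_slotImages_pilotRegion_eq,
      Set.iUnion_congr (fun γ => indTwo_smul_set p (fun b => (σ.localFields p).k (e b)) γ _),
      realPrimePacketWith_pilotRegion_succ_eq]
    refine hcont.trans (le_of_eq ?_)
    exact hcore.symm

end PlaceSection

end Summit.ABC.IUTFork.Thm311.Real

end
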